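import Literature.NumberTheory.Sieve.HeathBrownMorozResidueClasses
import HarnessLib

/-!
# Heath-Brown–Moroz class counts in box coordinates, and the scale change of the main term, PROVED

Topic `Literature/NumberTheory/Sieve`, namespace `Literature.NumberTheory.Sieve.CubicPrimes`
(continuation of `HeathBrownMorozResidueClasses.lean`).

[HeathBrownMoroz2004, Theorem 2] counts pairs `X' < u, v ≤ X'(1+η')` with `(a + du)³ + 2(b + dv)³`
prime (`residueClassPrimeCount X' η' d a b`).  In the coordinates `x = a + du`, `y = b + dv` this is
the number of pairs `(x, y)` in the classes `x ≡ a`, `y ≡ b (mod d)` of the box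
`(a + dX', a + dX'(1+η')] × (b + dX', b + dX'(1+η')]` with `(x, y) = 1` and `x³ + 2y³` prime
(`residueClassPrimeCount_eq_card_classPairs`, for `a, b < d`).  With `X' = (X − a)/d` the lower
corner is `(X, X + (b − a))`, and the main term rescales as
`M((X − a)/d) · d² / M(X) → 1` (`tendsto_mainTerm_sub_div_mul_sq_div`), `M = mainTerm c σ₀`;
the sides of the two boxes agree to first order, `(X − a)η′/(Xη) → 1` with `η′ = (log((X−a)/d))^{−c}`
(`tendsto_rpow_log_sub_div_div`, `tendsto_side_ratio`), so the strips making up their symmetric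
difference have relative width `|Xη − (X − a)η′|/(Xη) → 0` (`tendsto_width_div_side`).
These are the coordinate-change and scale-change steps of the parity-ideate route
`GoldbachHeathBrownDispersion`'s support item «ClassTransfer» (ii).  No new facts.  Written for the
parity-ideate cell (literature seat g14, 2026-08-27).

## References

* [HeathBrownMoroz2004] D. R. Heath-Brown, B. Z. Moroz, *On primes represented by cubic polynomials*,
  Proc. LMS (3) 88 (2004), Theorem 2 and §1 (1.2).
* [HeathBrownActa2001] D. R. Heath-Brown, *Primes represented by x³ + 2y³*, Acta Math. 186 (2001), Thm 1.
-/

noncomputable section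

open Finset Filter Topology Asymptotics

namespace Literature.NumberTheory.Sieve.CubicPrimes

/-! ### The class count in box coordinates -/

/-- **`residueClassPrimeCount` in the coordinates `x = a + du`, `y = b + dv`** (`a, b < d`): the
pairs `(x, y)` with `x ≡ a`, `y ≡ b (mod d)`, `a + dX' < x ≤ a + dX'(1+η')`,
`b + dX' < y ≤ b + dX'(1+η')`, `(x, y) = 1`, `x³ + 2y³` prime.
[cite: HeathBrownMoroz2004, §1 (1.2) (f(x⃗) = N(γ + d x⃗))] -/
theorem residueClassPrimeCount_eq_card_classPairs {d a b : ℕ} (hd : 0 < d) (ha : a < d) (hb : b < d)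
    (X' η' : ℝ) :
    residueClassPrimeCount X' η' d a b =
      #{xy ∈ Iic ⌊(a : ℝ) + d * (X' * (1 + η'))⌋₊ ×ˢ Iic ⌊(b : ℝ) + d * (X' * (1 + η'))⌋₊ |
          xy.1 ≡ a [MOD d] ∧ xy.2 ≡ b [MOD d] ∧
          ((a : ℝ) + d * X' < xy.1 ∧ (xy.1 : ℝ) ≤ a + d * (X' * (1 + η'))) ∧
          ((b : ℝ) + d * X' < xy.2 ∧ (xy.2 : ℝ) ≤ b + d * (X' * (1 + η'))) ∧
          Nat.Coprime xy.1 xy.2 ∧ (xy.1 ^ 3 + 2 * xy.2 ^ 3).Prime} := by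
  classical
  rw [residueClassPrimeCount_def]
  have hd' : (0 : ℝ) < d := by exact_mod_cast hd
  -- `x = a + d u ↔ u = x / d` on the class `x ≡ a (mod d)` (`a < d`)
  have hdiv : ∀ {e x : ℕ}, e < d → x ≡ e [MOD d] → e + d * (x / d) = x := by
    intro e x he hx
    have h1 : x % d = e := by rw [hx, Nat.mod_eq_of_lt he]
    have h2 := Nat.div_add_mod x d
    omega
  have hquot : ∀ {e u : ℕ}, e < d → (e + d * u) / d = u := by
    intro e u he
    rw [Nat.add_mul_div_left _ _ hd, Nat.div_eq_of_lt he, zero_add]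
  have hmod : ∀ (e u : ℕ), e + d * u ≡ e [MOD d] := by
    intro e u
    rw [Nat.ModEq, Nat.add_mul_mod_self_left]
  refine card_nbij' (fun uv => (a + d * uv.1, b + d * uv.2)) (fun xy => (xy.1 / d, xy.2 / d))
    ?_ ?_ ?_ ?_
  · rintro ⟨u, v⟩ huv
    rw [mem_coe] at huv
    obtain ⟨hu1, hu2, hv1, hv2, hcop, hpr⟩ := mem_residueClassPrimePairs_iff.mp huv
    simp only [mem_coe, mem_filter, mem_product, mem_Iic]
    have hu2' : ((a + d * u : ℕ) : ℝ) ≤ a + d * (X' * (1 + η')) := by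
      push_cast; nlinarith
    have hv2' : ((b + d * v : ℕ) : ℝ) ≤ b + d * (X' * (1 + η')) := by
      push_cast; nlinarith
    refine ⟨⟨Nat.le_floor hu2', Nat.le_floor hv2'⟩, hmod a u, hmod b v, ⟨?_, hu2'⟩, ⟨?_, hv2'⟩,
      hcop, hpr⟩
    · push_cast; nlinarith
    · push_cast; nlinarith
  · rintro ⟨x, y⟩ hxy
    rw [mem_coe, mem_filter] at hxy
    obtain ⟨-, hxa, hyb, ⟨hx1, hx2⟩, ⟨hy1, hy2⟩, hcop, hpr⟩ := hxy
    have ex : a + d * (x / d) = x := hdiv ha hxa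
    have ey : b + d * (y / d) = y := hdiv hb hyb
    rw [mem_coe, mem_residueClassPrimePairs_iff, ex, ey]
    have ex' : (x : ℝ) = a + d * ((x / d : ℕ) : ℝ) := by exact_mod_cast ex.symm
    have ey' : (y : ℝ) = b + d * ((y / d : ℕ) : ℝ) := by exact_mod_cast ey.symm
    refine ⟨?_, ?_, ?_, ?_, hcop, hpr⟩
    · rw [ex'] at hx1; nlinarith
    · rw [ex'] at hx2; nlinarith
    · rw [ey'] at hy1; nlinarith
    · rw [ey'] at hy2; nlinarith
  · rintro ⟨u, v⟩ -
    simp only [hquot ha, hquot hb]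
  · rintro ⟨x, y⟩ hxy
    rw [mem_coe, mem_filter] at hxy
    obtain ⟨-, hxa, hyb, -⟩ := hxy
    simp only [hdiv ha hxa, hdiv hb hyb]

/-- With `X' = (X − a)/d` the box of `residueClassPrimeCount_eq_card_classPairs` has lower corner
`(X, X + (b − a))` and side `(X − a)η'`: `a + dX' = X`, `a + dX'(1+η') = X + (X − a)η'`,
`b + dX' = X + (b − a)`. [cite: HeathBrownMoroz2004, §1 (1.2)] -/
theorem classBox_corners {d : ℕ} (hd : 0 < d) (a b : ℕ) (X η' : ℝ) :
    (a : ℝ) + d * ((X - a) / d) = X ∧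
      (a : ℝ) + d * ((X - a) / d * (1 + η')) = X + (X - a) * η' ∧
      (b : ℝ) + d * ((X - a) / d) = X + ((b : ℝ) - a) := by
  have hd' : (d : ℝ) ≠ 0 := by exact_mod_cast hd.ne'
  refine ⟨?_, ?_, ?_⟩
  · field_simp; ring
  · field_simp; ring
  · field_simp; ring

/-! ### The scale change of the main term -/

/-- `log((X − a)/d) / log X → 1`. [cite: HeathBrownActa2001, Theorem 1 (the scale X)] -/
theorem tendsto_log_sub_div_div_log (a d : ℝ) (hd : 0 < d) :
    Tendsto (fun X : ℝ => Real.log ((X - a) / d) / Real.log X) atTop (𝓝 1) := by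
  -- `log((X−a)/d) = log X + (log(X − a) − log X) − log d`, the bracket → 0, and `log X → ∞`
  have h1 : Tendsto (fun X : ℝ => Real.log (X + -a) - Real.log X) atTop (𝓝 0) :=
    Real.tendsto_log_comp_add_sub_log (-a)
  have h2 : Tendsto (fun X : ℝ => (Real.log (X + -a) - Real.log X - Real.log d) / Real.log X)
      atTop (𝓝 0) :=
    (h1.sub_const (Real.log d)).div_atTop Real.tendsto_log_atTop
  have h3 : Tendsto (fun X : ℝ => 1 + (Real.log (X + -a) - Real.log X - Real.log d) / Real.log X)
      atTop (𝓝 1) := by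
    simpa using h2.const_add 1
  refine h3.congr' ?_
  filter_upwards [eventually_gt_atTop (1 : ℝ), eventually_gt_atTop a] with X hX1 hXa
  have hL : Real.log X ≠ 0 := (Real.log_pos hX1).ne'
  have hXa' : 0 < X - a := by linarith
  rw [Real.log_div hXa'.ne' hd.ne', show X + -a = X - a by ring]
  field_simp
  ring

/-- **Scale change of the main term**: `M((X − a)/d) · d² / M(X) → 1` as `X → ∞`, `M = mainTerm c σ₀`
(`σ₀ ≠ 0`, `d > 0`). [cite: HeathBrownActa2001, Theorem 1 (M(X) = σ₀ η²X²/(3 log X), η = (log X)^{−c})] -/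
theorem tendsto_mainTerm_sub_div_mul_sq_div {c σ₀ : ℝ} (hσ : σ₀ ≠ 0) (a : ℝ) {d : ℝ} (hd : 0 < d) :
    Tendsto (fun X : ℝ => mainTerm c σ₀ ((X - a) / d) * d ^ 2 / mainTerm c σ₀ X) atTop (𝓝 1) := by
  -- the ratio equals `(log X'/log X)^{−(2c+1)} · ((X − a)/X)²` eventually
  have hlog := tendsto_log_sub_div_div_log a d hd
  have hpow : Tendsto (fun X : ℝ => (Real.log ((X - a) / d) / Real.log X) ^ (-(2 * c + 1)))
      atTop (𝓝 1) := by
    have hc : ContinuousAt (fun t : ℝ => t ^ (-(2 * c + 1))) 1 :=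
      Real.continuousAt_rpow_const _ _ (Or.inl one_ne_zero)
    have := hc.tendsto.comp hlog
    rw [Real.one_rpow] at this
    exact this
  have hlin : Tendsto (fun X : ℝ => ((X - a) / X) ^ 2) atTop (𝓝 1) := by
    have h1 : Tendsto (fun X : ℝ => 1 - a / X) atTop (𝓝 (1 - 0)) :=
      tendsto_const_nhds.sub (tendsto_const_nhds.div_atTop tendsto_id)
    rw [sub_zero] at h1
    have h2 := h1.pow 2
    rw [one_pow] at h2
    refine h2.congr' ?_
    filter_upwards [eventually_gt_atTop (0 : ℝ)] with X hX
    rw [sub_div, div_self hX.ne']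
  have hprod := hpow.mul hlin
  rw [one_mul] at hprod
  refine hprod.congr' ?_
  filter_upwards [eventually_gt_atTop (1 : ℝ), eventually_gt_atTop (a + d)] with X hX1 hXa
  have hX0 : X ≠ 0 := by linarith
  have hX'1 : 1 < (X - a) / d := by rw [lt_div_iff₀ hd]; linarith
  have hL : 0 < Real.log X := Real.log_pos hX1
  have hL' : 0 < Real.log ((X - a) / d) := Real.log_pos hX'1
  rw [mainTerm_def, mainTerm_def]
  set L := Real.log X with hLdef
  set L' := Real.log ((X - a) / d) with hL'def
  have hLne : L ≠ 0 := hL.ne'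
  have hL'ne : L' ≠ 0 := hL'.ne'
  have hr : 0 < L' / L := div_pos hL' hL
  have hA : L ^ (-c) ≠ 0 := (Real.rpow_pos_of_pos hL _).ne'
  have hA' : L' ^ (-c) ≠ 0 := (Real.rpow_pos_of_pos hL' _).ne'
  -- `(L'/L)^{-(2c+1)} = (L'^{-c}/L^{-c})² · (L/L')`
  have hkey : (L' / L) ^ (-(2 * c + 1)) = (L' ^ (-c) / L ^ (-c)) ^ 2 * (L / L') := by
    rw [show (-(2 * c + 1) : ℝ) = (-c + -c) + -1 by ring, Real.rpow_add hr, Real.rpow_add hr,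
      Real.rpow_neg_one, inv_div, Real.div_rpow hL'.le hL.le]
    ring
  rw [hkey]
  have hd0 : d ≠ 0 := hd.ne'
  field_simp

/-! ### The side and the width of the rescaled box -/

/-- **`η′/η → 1`**: `(log((X − a)/d))^{−c} / (log X)^{−c} → 1`.
[cite: HeathBrownActa2001, Theorem 1 (η = (log X)^{−c})] -/
theorem tendsto_rpow_log_sub_div_div (a : ℝ) {d : ℝ} (hd : 0 < d) (c : ℝ) :
    Tendsto (fun X : ℝ => Real.log ((X - a) / d) ^ (-c) / Real.log X ^ (-c)) atTop (𝓝 1) := by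
  have hlog := tendsto_log_sub_div_div_log a d hd
  have hc : ContinuousAt (fun t : ℝ => t ^ (-c)) 1 :=
    Real.continuousAt_rpow_const _ _ (Or.inl one_ne_zero)
  have h := hc.tendsto.comp hlog
  rw [Real.one_rpow] at h
  refine h.congr' ?_
  filter_upwards [eventually_gt_atTop (1 : ℝ), eventually_gt_atTop (a + d)] with X hX1 hXa
  have hX'1 : 1 < (X - a) / d := by rw [lt_div_iff₀ hd]; linarith
  have hL : 0 < Real.log X := Real.log_pos hX1
  have hL' : 0 < Real.log ((X - a) / d) := Real.log_pos hX'1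
  show (Real.log ((X - a) / d) / Real.log X) ^ (-c) = _
  rw [Real.div_rpow hL'.le hL.le]

/-- **The side ratio tends to one**: `(X − a)(log((X−a)/d))^{−c} / (X (log X)^{−c}) → 1` — the side
`(X − a)η′` of the rescaled Heath-Brown–Moroz box over the side `Xη` of Heath-Brown's box.
[cite: HeathBrownActa2001, Theorem 1 (the box X < x, y ≤ X(1+η))] -/
theorem tendsto_side_ratio (a : ℝ) {d : ℝ} (hd : 0 < d) (c : ℝ) :
    Tendsto (fun X : ℝ => (X - a) * Real.log ((X - a) / d) ^ (-c) / (X * Real.log X ^ (-c)))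
      atTop (𝓝 1) := by
  have h1 : Tendsto (fun X : ℝ => (X - a) / X) atTop (𝓝 1) := by
    have h1' : Tendsto (fun X : ℝ => 1 - a / X) atTop (𝓝 (1 - 0)) :=
      tendsto_const_nhds.sub (tendsto_const_nhds.div_atTop tendsto_id)
    rw [sub_zero] at h1'
    refine h1'.congr' ?_
    filter_upwards [eventually_gt_atTop (0 : ℝ)] with X hX
    rw [sub_div, div_self hX.ne']
  have h2 := tendsto_rpow_log_sub_div_div a hd c
  have h := h1.mul h2
  rw [one_mul] at h
  refine h.congr' (Eventually.of_forall fun X => ?_)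
  exact (mul_div_mul_comm (X - a) (Real.log ((X - a) / d) ^ (-c)) X (Real.log X ^ (-c))).symm

/-- **The strips are thin**: the relative width `|Xη − (X − a)η′| / (Xη) → 0`
(`η = (log X)^{−c}`, `η′ = (log((X−a)/d))^{−c}`). [cite: HeathBrownActa2001, Theorem 1 (η = (log X)^{−c})] -/
theorem tendsto_width_div_side (a : ℝ) {d : ℝ} (hd : 0 < d) (c : ℝ) :
    Tendsto (fun X : ℝ => |X * Real.log X ^ (-c) - (X - a) * Real.log ((X - a) / d) ^ (-c)| /
      (X * Real.log X ^ (-c))) atTop (𝓝 0) := by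
  have h := tendsto_side_ratio a hd c
  have h1 : Tendsto (fun X : ℝ => |1 - (X - a) * Real.log ((X - a) / d) ^ (-c) /
      (X * Real.log X ^ (-c))|) atTop (𝓝 0) := by
    have := (tendsto_const_nhds (x := (1 : ℝ))).sub h
    rw [sub_self] at this
    simpa using this.abs
  refine h1.congr' ?_
  filter_upwards [eventually_gt_atTop (1 : ℝ)] with X hX1
  have hpos : 0 < X * Real.log X ^ (-c) :=
    mul_pos (by linarith) (Real.rpow_pos_of_pos (Real.log_pos hX1) _)
  rw [one_sub_div hpos.ne', abs_div, abs_of_pos hpos]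

end Literature.NumberTheory.Sieve.CubicPrimes

end
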